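import Mathlib
import HarnessLib
import Summits.NavierStokesRegularity.NavierStokesRegularity.Theses.PoloidalWindowDoor
import Summits.NavierStokesRegularity.NavierStokesRegularity.Theorems.PoloidalWindowDoorPoloidalWindowRigiditySharper
import Summits.NavierStokesRegularity.NavierStokesRegularity.Theorems.PoloidalWindowDoorPoloidalWindowRigidityK2OfLrcSpatial
import Summits.NavierStokesRegularity.NavierStokesRegularity.Theorems.PoloidalWindowDoorPoloidalWindowRigidityHorizontalFlatPast
import Summits.NavierStokesRegularity.NavierStokesRegularity.Theorems.PoloidalWindowDoorPoloidalWindowRigidityEntireGerm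
import Summits.NavierStokesRegularity.NavierStokesRegularity.Theorems.PoloidalWindowDoorPoloidalWindowRigidityTimeShearLiminf
import Summits.NavierStokesRegularity.NavierStokesRegularity.Theorems.PoloidalWindowDoorPoloidalWindowRigidityK2OfLrcSlope
import Summits.NavierStokesRegularity.NavierStokesRegularity.Theorems.PoloidalWindowDoorPoloidalWindowRigidityStubUntwisted

/-!
# SKELETON `lrc-jet` (v5) — crux `PoloidalWindowRigidity` (K2, stmt-NavierStokesRegularity-19708), route `PoloidalWindowDoor`
# (K2 lead ns-poloidal-K2-p1 g6, 2026-08-27; v1 = g3; v2 = spatial pins + (TV) split; v3 = (TV) closed, ONE research stub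
# modulo entire germs; v4 = split by the dependence of the slope ((TH) / thick); v5 = SPLIT BY THE TWIST OF THE VORTEX-LINE
# FOLIATION instead: the UNTWISTED part — which contains (TH) ∩ untwisted, thick ∩ untwisted and every symmetric family — is
# closed on paper by a separation-of-variables argument along vertical lines (lead g6, UNTWISTED-NOTE.md in the crux
# directory, CAS-certified); the TWISTING part is the single research residue, a pure non-existence claim)

Composition: `PoloidalWindowRigidity` ⇐ (tree) `…Sharper.poloidalWindowRigidity_of_sliceSharpNonflatLiouville`
⇐ `sliceSharpNonflatLiouville_of_lrcJet` ⇐ (tree, ns-poloidal-K2-p3 g4) `…K2OfLrcSpatial.nonflatLiouville_of_lrc_spatial`,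
whose hypothesis `hLRC` is proved BY CONTRADICTION from the two stubs (`lrcSpatial_of_stubs`): on a non-degenerate open
space–time set `W` carrying the v3 pin (the slope is a function of `t` alone on no nonempty open subset) the TWIST BRACKET
`T = {∂₂v₂, v₂}ₕ := ∂₀(∂₂v₂)·∂₁v₂ − ∂₁(∂₂v₂)·∂₀v₂` — jointly continuous on the slab for class profiles (tree:
`…K2OfLrcSlope.analyticOnNhd_uncurry_fderiv_entry`, `…AnalyticPropagation.analyticOnNhd_uncurry_fderiv_slice_apply`) —
either vanishes identically on `W` (`stub_untwisted` ⇒ regular) or is non-zero on the nonempty open subset `W ∩ {T ≠ 0}`,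
which inherits non-degeneracy and the pin (`stub_twisting` ⇒ regular); both contradict the assumed singularity
(`ndRegular`).  `hTV` = `tv_of_stubs` (tree) as in v3/v4.

TWO REGISTERED STUBS (both for profiles of the route's Type-I class, poloidal along `e₃`, both ending in `¬ singular`):
* `stub_untwisted` — **NON-DEGENERATE + UNTWISTED ⇒ regular (lead; PROVED ON PAPER — UNTWISTED-NOTE.md — Lean in
  progress).**  On a nonempty open space–time set `W` of the slab where the profile is non-degenerate (`curl v ≠ 0`,
  `∇ₕv₂ ≠ 0`, `∂₂vₕ ≠ 0`) and the twist bracket vanishes (`∂₂v₂` is constant along the vortex lines; equivalently the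
  horizontal unit normal `∇ₕv₂/|∇ₕv₂|` does not turn with height; equivalently, locally `v₂ = G(u(xₕ,t), x₂, t)`: all
  horizontal planes carry the SAME foliation), the apex is regular.  NO hypothesis on the slope is needed.  PROOF SKETCH:
  poloidal NS in structure-function currency is the height-evolution `∂₂φ = F(v₂,x₂,t)`, `∂₂v₂ = −Δₕφ` (Hamiltonian in x₂)
  plus ONE scalar identity per plane (NS₃, normal form (V0): `(1−Λ)(∂ₜ+v·∇)v₂ = (1−Λ)(Δₕv₂ + ∂₂²v₂) − Λ_w(|∇ₕv₂|² + (∂₂v₂)²)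
  − 2Λ_z ∂₂v₂ − K(v₂,x₂,t)`, CAS kit j282615); with `v₂ = G(u,x₂,t)`, `∂₂φ = Q(u,x₂,t)`, `φ = R(u,x₂,t) + φ₀(xₕ,t)` the two
  identities `Δₕ(∂₂φ) + ∂₂²v₂ = 0` and (V0) are AFFINE in the planar quantities `X = |∇u|²`, `Y = Δu`, `Z′ = ∇φ₀·∇u + uₜ` with
  coefficients depending on `(u,x₂,t)` only (CAS kit j282682: `RV0 = (1−Λ)G_u[Z′ − c₁X − Y] + c₀`); differentiating in `x₂`
  along a vertical line separates variables: (1) if the `x₂`-Wronskian of `(Q_{uu}, Q_u)` is non-zero, `X, Y` are functions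
  of `u` — `u` is ISOPARAMETRIC in the plane; (2) otherwise `Q = d(x₂,t)u + e` after reparametrising `u`, `Δu = M(u,t)`,
  `G_{x₂x₂} = −d·M` (the Stuart-column structure of refuter1's kinematic witness), and (V0) gives `Z′ = c₁X + c̃₀` with
  `c₁ = G_{uu}/(G_u − d) − D(x₂,t)`, `D_{x₂} = d`: (2a) `∂_{x₂}c₁ ≠ 0` ⇒ `X` a function of `u` ⇒ isoparametric; (2b)
  `∂_{x₂}c₁ ≡ 0` ⇒ `G_u = d + Γ(u,t)e^{E+Du}` with `Γ ≠ 0` FORCED by the pin `Λ = d/G_u ≠ 1`, and comparing `∂_u G_{x₂x₂} =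
  −d M_u` with `∂²_{x₂}G_u` yields `Γ e^{Du}·P₂(u,x₂) = −d M_u − d_{x₂x₂}` with `P₂` quadratic in `u` of leading coefficient
  `d² ≠ 0` — impossible at three heights with distinct `D` (exponential polynomials with distinct rates are independent).  So
  `u` is isoparametric with a HEIGHT-INDEPENDENT foliation ⇒ planar Levi-Civita–Segre (tree `Literature…PlaneIsoparametric*`,
  lead g5) ⇒ concentric circles about ONE vertical axis or parallel lines ⇒ rotation / translation germ of `v₂`, of the
  Clebsch stream function (structure function, K2-p3 p531376) and of the vorticity (K2-p3 p536150) on an open set of one slice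
  ⇒ regular (tree `…KillingOpenSet`, `…LocalVorticitySymmetry`).  Consistency checks: every symmetric family (axisymmetric
  no-swirl about a fixed or time-dependent axis, dressed or not; planar; K2-p2's (TH) families F1/F2) is untwisted; the explicit
  NON-symmetric poloidal NS flows of the tree (refuter1's `…Negative.CrossedSuctionLayers`, constant slope 1/2) are TWISTED.
* `stub_twisting` — **NON-DEGENERATE + v3 PIN + TWISTING ⇒ regular (RESEARCH RESIDUE).**  Same class hypotheses; on `W`
  the profile is non-degenerate, the slope is a function of `t` alone on no nonempty open subset of `W`, and the twist bracket
  is NON-ZERO pointwise.  Expected VACUOUS off the constant-slope stratum: no twisting poloidal NS germ with non-constant slope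
  is known (the twisting examples in print/tree — oblique suction layers, Kelvin-mode triads — all have spatially constant
  slope, a stratum closed in the class by `…TimeShearClosed`/`shear_of_local_shear`); cert-1 g2's dimension count predicts
  none.  Handles for a prover (lead's NOTES / UNTWISTED-NOTE §5): on a twisting germ the tangential horizontal velocity is
  ALGEBRAIC in the 3-jet of `v₂` (`v_τ = (∂₂(vₕ·n) − Λ|∇ₕv₂|)/γ`, `γ` = twist rate) and `∂₂v_τ = −(vₕ·n)γ`,
  `curlₕvₕ = 0`, `divₕvₕ = −∂₂v₂` are three further scalar PDEs for the single unknown `v₂` besides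
  `ΔₕF(v₂,x₂,t) + ∂₂²v₂ = 0`; K2-p3 g5's AXIS-NOTE closes the sub-case «twisting ∧ per-plane isoparametric» in the class;
  (TH) ∩ twisting is K2-p2 g4's jet question (RESULT B); the (TV)/(CS) sub-case is a tree theorem.

Dropped from the registered list: v4's `stub_timeHeightShear` ((TH); its untwisted part is inside `stub_untwisted`, its
twisting part inside `stub_twisting`; K2-p2's landed (TH) bricks p530500/p533107/p534064/p536784 stay tree theorems) and
v4's `stub_lrcGeneric` (20428's currency, lead-of-item K2-p3; 19708 needs only `¬ singular`).
Every other piece is a tree theorem (v1–v4 docstrings).  WHAT THIS IS NOT: not a proof of K2 — a registered decomposition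
with one stub proved on paper and one research-sized non-existence stub; nothing about Clay (A).
-/

-- the summit and its single sub-problem share the name (CONVENTIONS §1)
set_option linter.dupNamespace false

namespace Summit.NavierStokesRegularity.NavierStokesRegularity.Theses.PoloidalWindowDoor

open Set Function
open scoped RealInnerProductSpace InnerProductSpace
open Literature.Analysis Literature.Analysis.FluidPDE
open Summit.NavierStokesRegularity.NavierStokesRegularity.Theorems.PoloidalWindowDoorPoloidalWindowRigiditySharper
open Summit.NavierStokesRegularity.NavierStokesRegularity.Theorems.PoloidalWindowDoorPoloidalWindowRigidityK2OfLrcSpatial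
open Summit.NavierStokesRegularity.NavierStokesRegularity.Theorems.PoloidalWindowDoorPoloidalWindowRigidityHorizontalFlatPast
open Summit.NavierStokesRegularity.NavierStokesRegularity.Theorems.PoloidalWindowDoorPoloidalWindowRigidityEntireGerm
open Summit.NavierStokesRegularity.NavierStokesRegularity.Theorems.PoloidalWindowDoorPoloidalWindowRigidityK2OfLrcSlope
open Summit.NavierStokesRegularity.NavierStokesRegularity.Theorems.TubeAlternative.AnalyticPropagation

/-- **STUB: NON-DEGENERATE + UNTWISTED ⇒ regular (v5; proved on paper — UNTWISTED-NOTE.md; Lean in progress, lead).**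
For a profile of the route's Type-I class, poloidal along `e₃`: on a nonempty open space–time subset `W` of the backward slab
on which the profile is non-degenerate (`curl v ≠ 0`, `∇_h v₂ ≠ 0`, `∂₂v_h ≠ 0` pointwise) and the vortex-line foliation is
UNTWISTED — the planar bracket `{∂₂v₂, v₂}ₕ = ∂₀(∂₂v₂)·∂₁v₂ − ∂₁(∂₂v₂)·∂₀v₂` vanishes pointwise (the horizontal unit normal
`∇ₕv₂/|∇ₕv₂|` of the vortex lines does not turn with height) — the apex is regular.  No hypothesis on the shear slope.
Mechanism: separation of variables in the height along every vertical line forces `v₂(t,·,x₂)` to be isoparametric in every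
plane with a height-independent foliation, hence (planar Levi-Civita–Segre, tree) the vorticity has a rotation/translation
germ on an open set of one slice, hence (tree) the apex is regular; the degenerate branch is the Stuart-column structure,
killed by NS₃ through an exponential-rank identity and the pin `Λ ≠ 1`. -/
theorem stub_untwisted :
    ∀ (C : ℝ) (v : ℝ → EuclideanSpace ℝ (Fin 3) → EuclideanSpace ℝ (Fin 3)),
      Literature.Analysis.FluidPDE.HasTypeITimeDecay C v →
      ContinuousOn (Function.uncurry v) (Set.Iio (0 : ℝ) ×ˢ Set.univ) →
      (∀ s t : ℝ, s < t → t < 0 → ∀ x, v t x =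
        Literature.Analysis.UnboundedOperators.heatExtension (v s) (t - s) x -
          Literature.Analysis.FluidPDE.oseenDuhamel 1 s v v t x) →
      (∀ t < 0, Literature.Analysis.FluidPDE.VectorCalculus.IsDivFree (v t)) →
      (∀ s < 0, ∀ y, ⟪Literature.Analysis.FluidPDE.curl (v s) y, EuclideanSpace.single 2 1⟫_ℝ = 0) →
      ∀ W : Set (ℝ × EuclideanSpace ℝ (Fin 3)), IsOpen W → W.Nonempty → W ⊆ Set.Iio (0 : ℝ) ×ˢ Set.univ →
        (∀ z ∈ W, Literature.Analysis.FluidPDE.curl (v z.1) z.2 ≠ 0 ∧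
          (fderiv ℝ (v z.1) z.2 (EuclideanSpace.single 0 1) 2 ≠ 0 ∨ fderiv ℝ (v z.1) z.2 (EuclideanSpace.single 1 1) 2 ≠ 0) ∧
          (fderiv ℝ (v z.1) z.2 (EuclideanSpace.single 2 1) 0 ≠ 0 ∨ fderiv ℝ (v z.1) z.2 (EuclideanSpace.single 2 1) 1 ≠ 0)) →
        (∀ z ∈ W,
          fderiv ℝ (fun x => fderiv ℝ (v z.1) x (EuclideanSpace.single 2 1) 2) z.2 (EuclideanSpace.single 0 1) *
              fderiv ℝ (v z.1) z.2 (EuclideanSpace.single 1 1) 2 -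
            fderiv ℝ (fun x => fderiv ℝ (v z.1) x (EuclideanSpace.single 2 1) 2) z.2 (EuclideanSpace.single 1 1) *
              fderiv ℝ (v z.1) z.2 (EuclideanSpace.single 0 1) 2 = 0) →
        ¬ Literature.Analysis.FluidPDE.IsBackwardSingularPoint v 0 :=
  Summit.NavierStokesRegularity.NavierStokesRegularity.Theorems.PoloidalWindowDoorPoloidalWindowRigidityStubUntwisted.stub_untwisted

/-- **STUB: NON-DEGENERATE + v3 PIN + TWISTING ⇒ regular (v5; RESEARCH RESIDUE — expected vacuous).**  Same class hypotheses;
on the nonempty open `W` the profile is non-degenerate, the shear slope is a function of time alone on NO nonempty open subset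
of `W` (v3 pin: excludes the constant-slope / (TV) stratum, where twisting germs DO exist locally — refuter1's
`…Negative.CrossedSuctionLayers` — but which is closed in the class by `…TimeShearClosed`), and the twist bracket
`{∂₂v₂, v₂}ₕ` is NON-ZERO pointwise (the vortex-line foliation turns with height everywhere on `W`).  Then the apex is
regular.  Frame facts available to a prover (UNTWISTED-NOTE §5): on a twisting germ the tangential horizontal velocity is
algebraic in the 3-jet of `v₂` (`v_τ = (∂₂(vₕ·n) − Λ|∇ₕv₂|)/γ`, `γ` = twist rate) and `∂₂v_τ = −(vₕ·n)γ`, `curlₕvₕ = 0`,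
`divₕvₕ = −∂₂v₂` are three further scalar PDEs for `v₂` besides `ΔₕF(v₂,x₂,t) + ∂₂²v₂ = 0`; K2-p3 g5's AXIS-NOTE closes
the sub-case «twisting ∧ per-plane isoparametric» in the class. -/
theorem stub_twisting :
    ∀ (C : ℝ) (v : ℝ → EuclideanSpace ℝ (Fin 3) → EuclideanSpace ℝ (Fin 3)),
      Literature.Analysis.FluidPDE.HasTypeITimeDecay C v →
      ContinuousOn (Function.uncurry v) (Set.Iio (0 : ℝ) ×ˢ Set.univ) →
      (∀ s t : ℝ, s < t → t < 0 → ∀ x, v t x =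
        Literature.Analysis.UnboundedOperators.heatExtension (v s) (t - s) x -
          Literature.Analysis.FluidPDE.oseenDuhamel 1 s v v t x) →
      (∀ t < 0, Literature.Analysis.FluidPDE.VectorCalculus.IsDivFree (v t)) →
      (∀ s < 0, ∀ y, ⟪Literature.Analysis.FluidPDE.curl (v s) y, EuclideanSpace.single 2 1⟫_ℝ = 0) →
      ∀ W : Set (ℝ × EuclideanSpace ℝ (Fin 3)), IsOpen W → W.Nonempty → W ⊆ Set.Iio (0 : ℝ) ×ˢ Set.univ →
        (∀ z ∈ W, Literature.Analysis.FluidPDE.curl (v z.1) z.2 ≠ 0 ∧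
          (fderiv ℝ (v z.1) z.2 (EuclideanSpace.single 0 1) 2 ≠ 0 ∨ fderiv ℝ (v z.1) z.2 (EuclideanSpace.single 1 1) 2 ≠ 0) ∧
          (fderiv ℝ (v z.1) z.2 (EuclideanSpace.single 2 1) 0 ≠ 0 ∨ fderiv ℝ (v z.1) z.2 (EuclideanSpace.single 2 1) 1 ≠ 0)) →
        (∀ m : ℝ → ℝ, ∀ W₁ : Set (ℝ × EuclideanSpace ℝ (Fin 3)), W₁ ⊆ W → IsOpen W₁ → W₁.Nonempty →
          ∃ z ∈ W₁, ∃ b : Fin 3, b ≠ 2 ∧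
            fderiv ℝ (v z.1) z.2 (EuclideanSpace.single 2 1) b ≠
              m z.1 * fderiv ℝ (v z.1) z.2 (EuclideanSpace.single b 1) 2) →
        (∀ z ∈ W,
          fderiv ℝ (fun x => fderiv ℝ (v z.1) x (EuclideanSpace.single 2 1) 2) z.2 (EuclideanSpace.single 0 1) *
              fderiv ℝ (v z.1) z.2 (EuclideanSpace.single 1 1) 2 -
            fderiv ℝ (fun x => fderiv ℝ (v z.1) x (EuclideanSpace.single 2 1) 2) z.2 (EuclideanSpace.single 1 1) *
              fderiv ℝ (v z.1) z.2 (EuclideanSpace.single 0 1) 2 ≠ 0) →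
        ¬ Literature.Analysis.FluidPDE.IsBackwardSingularPoint v 0 := by
  sorry

/-- **NON-DEGENERATE + v3 PIN ⇒ regular (proved from the two stubs by the pointwise twist dichotomy).**  The twist bracket
`T(s,y) = ∂₀(∂₂v₂)·∂₁v₂ − ∂₁(∂₂v₂)·∂₀v₂` is jointly continuous on the backward slab (the Jacobian entries of a class
profile and their spatial derivatives are jointly real-analytic there: `…K2OfLrcSlope.analyticOnNhd_uncurry_fderiv_entry`,
`…AnalyticPropagation.analyticOnNhd_uncurry_fderiv_slice_apply`).  Hence either `T ≡ 0` on `W` (`stub_untwisted`), or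
`T ≠ 0` on the nonempty open subset `W ∩ {T ≠ 0}`, which inherits non-degeneracy and the pin (`stub_twisting`). -/
theorem ndRegular :
    ∀ (C : ℝ) (v : ℝ → EuclideanSpace ℝ (Fin 3) → EuclideanSpace ℝ (Fin 3)),
      Literature.Analysis.FluidPDE.HasTypeITimeDecay C v →
      ContinuousOn (Function.uncurry v) (Set.Iio (0 : ℝ) ×ˢ Set.univ) →
      (∀ s t : ℝ, s < t → t < 0 → ∀ x, v t x =
        Literature.Analysis.UnboundedOperators.heatExtension (v s) (t - s) x -
          Literature.Analysis.FluidPDE.oseenDuhamel 1 s v v t x) →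
      (∀ t < 0, Literature.Analysis.FluidPDE.VectorCalculus.IsDivFree (v t)) →
      (∀ s < 0, ∀ y, ⟪Literature.Analysis.FluidPDE.curl (v s) y, EuclideanSpace.single 2 1⟫_ℝ = 0) →
      ∀ W : Set (ℝ × EuclideanSpace ℝ (Fin 3)), IsOpen W → W.Nonempty → W ⊆ Set.Iio (0 : ℝ) ×ˢ Set.univ →
        (∀ z ∈ W, Literature.Analysis.FluidPDE.curl (v z.1) z.2 ≠ 0 ∧
          (fderiv ℝ (v z.1) z.2 (EuclideanSpace.single 0 1) 2 ≠ 0 ∨ fderiv ℝ (v z.1) z.2 (EuclideanSpace.single 1 1) 2 ≠ 0) ∧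
          (fderiv ℝ (v z.1) z.2 (EuclideanSpace.single 2 1) 0 ≠ 0 ∨ fderiv ℝ (v z.1) z.2 (EuclideanSpace.single 2 1) 1 ≠ 0)) →
        (∀ m : ℝ → ℝ, ∀ W₁ : Set (ℝ × EuclideanSpace ℝ (Fin 3)), W₁ ⊆ W → IsOpen W₁ → W₁.Nonempty →
          ∃ z ∈ W₁, ∃ b : Fin 3, b ≠ 2 ∧
            fderiv ℝ (v z.1) z.2 (EuclideanSpace.single 2 1) b ≠
              m z.1 * fderiv ℝ (v z.1) z.2 (EuclideanSpace.single b 1) 2) →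
        ¬ Literature.Analysis.FluidPDE.IsBackwardSingularPoint v 0 := by
  intro C v hrate hcont hmild hdiv hpol W hW hWne hWs hnd hpin
  -- the twist bracket as a function on space–time
  set T : ℝ × EuclideanSpace ℝ (Fin 3) → ℝ := fun z =>
    fderiv ℝ (fun x => fderiv ℝ (v z.1) x (EuclideanSpace.single 2 1) 2) z.2 (EuclideanSpace.single 0 1) *
              fderiv ℝ (v z.1) z.2 (EuclideanSpace.single 1 1) 2 -
            fderiv ℝ (fun x => fderiv ℝ (v z.1) x (EuclideanSpace.single 2 1) 2) z.2 (EuclideanSpace.single 1 1) *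
              fderiv ℝ (v z.1) z.2 (EuclideanSpace.single 0 1) 2 with hT
  by_cases htw : ∃ z ∈ W, T z ≠ 0
  · -- TWISTING somewhere: restrict to the open set where `T ≠ 0`
    obtain ⟨z₀, hz₀W, hz₀⟩ := htw
    have hslab : IsOpen (Set.Iio (0 : ℝ) ×ˢ (Set.univ : Set (EuclideanSpace ℝ (Fin 3)))) :=
      isOpen_Iio.prod isOpen_univ
    have hD : ∀ j i : Fin 3, ContinuousOn
        (fun z : ℝ × EuclideanSpace ℝ (Fin 3) => fderiv ℝ (v z.1) z.2 (EuclideanSpace.single j 1) i)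
        (Set.Iio (0 : ℝ) ×ˢ Set.univ) := fun j i => continuousOn_fderiv_entry hrate hcont hmild j i
    have hD2 : ∀ b : Fin 3, ContinuousOn
        (fun z : ℝ × EuclideanSpace ℝ (Fin 3) =>
          fderiv ℝ (fun x => fderiv ℝ (v z.1) x (EuclideanSpace.single 2 1) 2) z.2 (EuclideanSpace.single b 1))
        (Set.Iio (0 : ℝ) ×ˢ Set.univ) := by
      intro b
      have h22 := analyticOnNhd_uncurry_fderiv_entry hrate hcont hmild 2 2
      have h := analyticOnNhd_uncurry_fderiv_slice_apply (w := fun s y => fderiv ℝ (v s) y (EuclideanSpace.single 2 1) 2)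
        h22 isOpen_Iio (v := fun _ _ => EuclideanSpace.single b 1) analyticOnNhd_const
      exact h.continuousOn
    have hTc : ContinuousOn T (Set.Iio (0 : ℝ) ×ˢ Set.univ) := by
      rw [hT]
      exact ((hD2 0).mul (hD 1 2)).sub ((hD2 1).mul (hD 0 2))
    have hO : IsOpen ((Set.Iio (0 : ℝ) ×ˢ Set.univ) ∩ T ⁻¹' {0}ᶜ) :=
      hTc.isOpen_inter_preimage hslab isOpen_compl_singleton
    set W₃ : Set (ℝ × EuclideanSpace ℝ (Fin 3)) := W ∩ ((Set.Iio (0 : ℝ) ×ˢ Set.univ) ∩ T ⁻¹' {0}ᶜ) with hW₃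
    have hW₃o : IsOpen W₃ := hW.inter hO
    have hW₃W : W₃ ⊆ W := Set.inter_subset_left
    have hW₃ne : W₃.Nonempty := ⟨z₀, hz₀W, hWs hz₀W, hz₀⟩
    refine stub_twisting C v hrate hcont hmild hdiv hpol W₃ hW₃o hW₃ne (hW₃W.trans hWs)
      (fun z hz => hnd z (hW₃W hz)) (fun m W₁ hW₁ hW₁o hW₁ne => hpin m W₁ (hW₁.trans hW₃W) hW₁o hW₁ne) ?_
    intro z hz
    exact hz.2.2
  · -- UNTWISTED on all of `W`
    push Not at htw
    exact stub_untwisted C v hrate hcont hmild hdiv hpol W hW hWne hWs hnd htw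

/-- **LRC″ with spatial pins, UNDER THE SINGULARITY ASSUMPTION, from the two stubs** (proved): the hypothesis `hLRC`
of `…K2OfLrcSpatial.nonflatLiouville_of_lrc_spatial` for a profile that IS backward-singular at the apex — vacuously, since
`ndRegular` (the twist dichotomy over the two stubs) says such a profile has no non-degenerate open set with the pin. -/
theorem lrcSpatial_of_stubs :
    ∀ (C : ℝ) (v : ℝ → EuclideanSpace ℝ (Fin 3) → EuclideanSpace ℝ (Fin 3)),
      Literature.Analysis.FluidPDE.HasTypeITimeDecay C v →
      ContinuousOn (Function.uncurry v) (Set.Iio (0 : ℝ) ×ˢ Set.univ) →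
      (∀ s t : ℝ, s < t → t < 0 → ∀ x, v t x =
        Literature.Analysis.UnboundedOperators.heatExtension (v s) (t - s) x -
          Literature.Analysis.FluidPDE.oseenDuhamel 1 s v v t x) →
      (∀ t < 0, Literature.Analysis.FluidPDE.VectorCalculus.IsDivFree (v t)) →
      (∀ s < 0, ∀ y, ⟪Literature.Analysis.FluidPDE.curl (v s) y, EuclideanSpace.single 2 1⟫_ℝ = 0) →
      Literature.Analysis.FluidPDE.IsBackwardSingularPoint v 0 →
      ∀ W : Set (ℝ × EuclideanSpace ℝ (Fin 3)), IsOpen W → W.Nonempty → W ⊆ Set.Iio (0 : ℝ) ×ˢ Set.univ →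
        (∀ z ∈ W, Literature.Analysis.FluidPDE.curl (v z.1) z.2 ≠ 0 ∧
          (fderiv ℝ (v z.1) z.2 (EuclideanSpace.single 0 1) 2 ≠ 0 ∨ fderiv ℝ (v z.1) z.2 (EuclideanSpace.single 1 1) 2 ≠ 0) ∧
          (fderiv ℝ (v z.1) z.2 (EuclideanSpace.single 2 1) 0 ≠ 0 ∨ fderiv ℝ (v z.1) z.2 (EuclideanSpace.single 2 1) 1 ≠ 0)) →
        (∀ m : ℝ → ℝ, ∀ W₁ : Set (ℝ × EuclideanSpace ℝ (Fin 3)), W₁ ⊆ W → IsOpen W₁ → W₁.Nonempty →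
          ∃ z ∈ W₁, ∃ b : Fin 3, b ≠ 2 ∧
            fderiv ℝ (v z.1) z.2 (EuclideanSpace.single 2 1) b ≠
              m z.1 * fderiv ℝ (v z.1) z.2 (EuclideanSpace.single b 1) 2) →
        ∃ s : ℝ, s < 0 ∧ ∃ U : Set (EuclideanSpace ℝ (Fin 3)), IsOpen U ∧ U.Nonempty ∧
          ((∃ e : EuclideanSpace ℝ (Fin 3), e ≠ 0 ∧ ∀ y ∈ U, fderiv ℝ (Literature.Analysis.FluidPDE.curl (v s)) y e = 0) ∨
           (∃ c : EuclideanSpace ℝ (Fin 3), ∀ y ∈ U,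
              Literature.Analysis.FluidPDE.rotGen (Literature.Analysis.FluidPDE.curl (v s) y) =
                fderiv ℝ (Literature.Analysis.FluidPDE.curl (v s)) y (Literature.Analysis.FluidPDE.rotGen (y - c)))) := by
  intro C v hrate hcont hmild hdiv hpol hsing W hW hWne hWs hnd hpin
  exact absurd hsing (ndRegular C v hrate hcont hmild hdiv hpol W hW hWne hWs hnd hpin)

/-- **(former STUB L2, now a TREE THEOREM) = (TV), BOUNDED-ALONG-A-SEQUENCE HALF** — the registered stub
`stub_tvLiminf` of v2, PROVED by ns-poloidal-K2-p2 g3 (p525351 `…TimeShearLiminf.stub_tvLiminf`, M12 variance run on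
`ψ = (1−μ)v₂` with the Grönwall started along the bounded sequence; bricks ns-poloidal-K2-p3 g4 p519098/p521329, K2-p2
p524146/p524699).  For a profile of the route's Type-I class, poloidal along `e₃`: if every slice `s < 0` is proportional-shear
with a negative real-analytic non-constant slope function bounded below along SOME sequence of times tending to `−∞`, then
`v` is not backward-singular at the apex. -/
theorem stub_tvLiminf :
    ∀ (C : ℝ) (v : ℝ → EuclideanSpace ℝ (Fin 3) → EuclideanSpace ℝ (Fin 3)),
      Literature.Analysis.FluidPDE.HasTypeITimeDecay C v →
      ContinuousOn (Function.uncurry v) (Set.Iio (0 : ℝ) ×ˢ Set.univ) →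
      (∀ s t : ℝ, s < t → t < 0 → ∀ x, v t x =
        Literature.Analysis.UnboundedOperators.heatExtension (v s) (t - s) x -
          Literature.Analysis.FluidPDE.oseenDuhamel 1 s v v t x) →
      (∀ t < 0, Literature.Analysis.FluidPDE.VectorCalculus.IsDivFree (v t)) →
      (∀ s < 0, ∀ y, ⟪Literature.Analysis.FluidPDE.curl (v s) y, EuclideanSpace.single 2 1⟫_ℝ = 0) →
      ∀ μ : ℝ → ℝ, (∀ s < 0, μ s < 0) → (∀ s < 0, AnalyticAt ℝ μ s) →
        (∃ s₁ s₂ : ℝ, s₁ < 0 ∧ s₂ < 0 ∧ μ s₁ ≠ μ s₂) →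
        (∀ s < 0, ∀ y, ∀ b : Fin 3, b ≠ 2 →
          fderiv ℝ (v s) y (EuclideanSpace.single 2 1) b = μ s * fderiv ℝ (v s) y (EuclideanSpace.single b 1) 2) →
        (∃ M : ℝ, ∀ T : ℝ, ∃ τ < T, -M ≤ μ τ) →
        ¬ Literature.Analysis.FluidPDE.IsBackwardSingularPoint v 0 :=
  Summit.NavierStokesRegularity.NavierStokesRegularity.Theorems.PoloidalWindowDoorPoloidalWindowRigidityTimeShearLiminf.stub_tvLiminf

/-- **(TV) from the two halves (proved).**  The hypothesis `hTV` of `…K2OfLrcSpatial.nonflatLiouville_of_lrc_spatial`,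
quantified over the class: the bounded-along-a-sequence half is `stub_tvLiminf`; otherwise `μ(τ) → −∞`, i.e.
`∀ M ∃ T ∀ τ < T, M ≤ |μ τ|`, and the lead's tree theorem `…HorizontalFlatPast.nonflatLiouville_of_timeShear_unbounded`
(growth branch, zoom-out) ends. -/
theorem tv_of_stubs :
    ∀ (C : ℝ) (v : ℝ → EuclideanSpace ℝ (Fin 3) → EuclideanSpace ℝ (Fin 3)),
      Literature.Analysis.FluidPDE.HasTypeITimeDecay C v →
      ContinuousOn (Function.uncurry v) (Set.Iio (0 : ℝ) ×ˢ Set.univ) →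
      (∀ s t : ℝ, s < t → t < 0 → ∀ x, v t x =
        Literature.Analysis.UnboundedOperators.heatExtension (v s) (t - s) x -
          Literature.Analysis.FluidPDE.oseenDuhamel 1 s v v t x) →
      (∀ t < 0, Literature.Analysis.FluidPDE.VectorCalculus.IsDivFree (v t)) →
      (∀ s < 0, ∀ y, ⟪Literature.Analysis.FluidPDE.curl (v s) y, EuclideanSpace.single 2 1⟫_ℝ = 0) →
      ∀ μ : ℝ → ℝ, (∀ s < 0, μ s < 0) → (∀ s < 0, AnalyticAt ℝ μ s) →
        (∃ s₁ s₂ : ℝ, s₁ < 0 ∧ s₂ < 0 ∧ μ s₁ ≠ μ s₂) →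
        (∀ s < 0, ∀ y, ∀ b : Fin 3, b ≠ 2 →
          fderiv ℝ (v s) y (EuclideanSpace.single 2 1) b = μ s * fderiv ℝ (v s) y (EuclideanSpace.single b 1) 2) →
        ¬ Literature.Analysis.FluidPDE.IsBackwardSingularPoint v 0 := by
  intro C v hrate hcont hmild hdiv hpol μ hneg han hnc hslope
  by_cases hB : ∃ M : ℝ, ∀ T : ℝ, ∃ τ < T, -M ≤ μ τ
  · exact stub_tvLiminf C v hrate hcont hmild hdiv hpol μ hneg han hnc hslope hB
  · push Not at hB
    refine nonflatLiouville_of_timeShear_unbounded hrate hcont hmild hdiv hpol hslope fun M => ?_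
    obtain ⟨T, hT⟩ := hB M
    refine ⟨T, fun τ hτ => ?_⟩
    have h1 : μ τ < -M := hT τ hτ
    have h2 : M < -μ τ := by linarith
    exact h2.le.trans (neg_le_abs (μ τ))

/-- **The slice-sharp residue of the `slicesharp` line from the two stubs** (its symmetry/genericity hypotheses are not
needed): class + poloidal ⇒ not backward-singular — by contradiction, K2-p3 g4's `nonflatLiouville_of_lrc_spatial` with
`lrcSpatial_of_stubs` (which uses the assumed singularity) and `tv_of_stubs`. -/
theorem sliceSharpNonflatLiouville_of_lrcJet :
    ∀ (C : ℝ) (v : ℝ → EuclideanSpace ℝ (Fin 3) → EuclideanSpace ℝ (Fin 3)),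
      Literature.Analysis.FluidPDE.HasTypeITimeDecay C v →
      ContinuousOn (Function.uncurry v) (Set.Iio (0 : ℝ) ×ˢ Set.univ) →
      (∀ s t : ℝ, s < t → t < 0 → ∀ x, v t x =
        Literature.Analysis.UnboundedOperators.heatExtension (v s) (t - s) x -
          Literature.Analysis.FluidPDE.oseenDuhamel 1 s v v t x) →
      (∀ t < 0, Literature.Analysis.FluidPDE.VectorCalculus.IsDivFree (v t)) →
      (∀ s < 0, ∀ y, ⟪Literature.Analysis.FluidPDE.curl (v s) y, EuclideanSpace.single 2 1⟫_ℝ = 0) →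
      (∀ s < 0, ∀ y, ⟪fderiv ℝ (v s) y (Literature.Analysis.FluidPDE.curl (v s) y), EuclideanSpace.single 2 1⟫_ℝ = 0) →
      (∀ s < 0, ∀ b : EuclideanSpace ℝ (Fin 3), b ≠ 0 → ∃ y,
        Literature.Analysis.FluidPDE.cross (Literature.Analysis.FluidPDE.curl (v s) y) b ≠ 0) →
      (∀ s < 0, ∃ y, fderiv ℝ (v s) y (EuclideanSpace.single 2 1) 0 ≠ 0 ∨
        fderiv ℝ (v s) y (EuclideanSpace.single 2 1) 1 ≠ 0) →
      (∀ s < 0, ∀ a : EuclideanSpace ℝ (Fin 3), a ≠ 0 → ⟪a, EuclideanSpace.single 2 1⟫_ℝ = 0 →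
        ∃ y, ⟪fderiv ℝ (v s) y a, EuclideanSpace.single 2 1⟫_ℝ ≠ 0) →
      (∀ s < 0, ∀ e : EuclideanSpace ℝ (Fin 3), e ≠ 0 → ∃ (y : EuclideanSpace ℝ (Fin 3)) (l : ℝ), v s (y + l • e) ≠ v s y) →
      (∀ s < 0, ∀ (L : EuclideanSpace ℝ (Fin 3) ≃ₗᵢ[ℝ] EuclideanSpace ℝ (Fin 3)) (c : EuclideanSpace ℝ (Fin 3)),
        ¬ Literature.Analysis.FluidPDE.IsAxisymmetric (fun y => L.symm (v s (L y + c)))) →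
      (∃ lam : ℝ, 0 < lam ∧ ∃ s < 0, ∃ y, lam • v (lam ^ 2 * s) (lam • y) ≠ v s y) →
      ¬ Literature.Analysis.FluidPDE.IsBackwardSingularPoint v 0 := by
  intro C v hrate hcont hmild hdiv hpol _ _ _ _ _ _ _ hsing
  exact nonflatLiouville_of_lrc_spatial hrate hcont hmild hdiv hpol
    (lrcSpatial_of_stubs C v hrate hcont hmild hdiv hpol hsing) (tv_of_stubs C v hrate hcont hmild hdiv hpol) hsing

/-- COMPOSITION (proved): the crux from the two stubs `stub_untwisted`, `stub_twisting`, via the landed reduction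
`…Sharper.poloidalWindowRigidity_of_sliceSharpNonflatLiouville`. -/
theorem PoloidalWindowRigidity_of_lrcJet : PoloidalWindowRigidity :=
  poloidalWindowRigidity_of_sliceSharpNonflatLiouville sliceSharpNonflatLiouville_of_lrcJet

end Summit.NavierStokesRegularity.NavierStokesRegularity.Theses.PoloidalWindowDoor
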